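import Mathlib
import HarnessLib
import Summits.HubbardSuperconductivity.HubbardSuperconductivity.Theorems.KLProgrammeKLRegimeVolumeLimitSunsetRateTerms

/-!
# Route `KLProgramme` — VL child `KLRegimeVolumeLimitV12` (stmt-HubbardSuperconductivity-19858): the ORDER-`U²` (SUNSET) RUNG of the
# registered CAUCHY stub `stub_vl_twoVolumeRate`, MODEL-FREE — the finite-volume two-loop functional of any admissible symbol family with
# a Lipschitz modulus obeys the two-volume rate with cross-grid torus modulus
# (cell gate-hubbard-kl, seat hubbard-kl-k3c4-p1 g4; PART 2/2 — the term-level lemmas are PART 1/2 `…VolumeLimitSunsetRateTerms`; companion of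
# `…VolumeLimitSunset` (limit form, g0) and `…ZeroCouplingRate` (order `U⁰`, g3))

THE OBJECT is `…VolumeLimitSunset.klSunset L M β g (ω, k⃗) σ = Σ_{(a,b) ∈ ℤ²} klSunsetTerm …`: at external fermionic Matsubara integer
`n = matsubaraInt M ω`, the `(a, b)` term is KEPT iff `a`, `b`, `n+b-a ∈ [-M, M-1]` and is then `β⁻² · L⁻²Σ_p L⁻²Σ_q g_a(p_p) g_b(p_q)
g_{n+b-a}(p_{k⃗+q-p})`.  ADMISSIBLE symbol families WITH MODULUS: each `g_a` is `2π`-periodic, `‖g_a(x)‖ ≤ C/|a+½|`, and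
`‖g_a(x) - g_a(y)‖ ≤ (K/|a+½|)·‖x - y‖_∞` (the frame propagator `(e_K(x) - iω_a)⁻¹` has `C = β/2π`, `K = 7√2·β²/(2π²)` under `FrameOK`).

THE THEOREM `klSunset_twoVolumeRate` / `klSunset_twoVolumeRate_stubShape`: for every such family and every `β > 0` there are an explicit
`D` and a sequence `ρ L → 0` such that for ALL volumes `1 ≤ L ≤ L′`, all cutoffs `M ≥ L`, `M′ ≥ L′`, every spin, all frequency labels
`ω ∈ MatsubaraIdx M`, `ω′ ∈ MatsubaraIdx M′` with the SAME Matsubara integer, and all torus momenta `k ∈ (ℤ/L)²`, `k′ ∈ (ℤ/L′)²`,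

  `‖klSunset L M β g (ω,k) σ - klSunset L′ M′ β g (ω′,k′) σ‖ ≤ ρ L + D · Σ_i |p_k i - p′_{k′} i|_𝕋`,
  `ρ L = β⁻²·48π K C² G²/L + β⁻²·6 C³ H²·((L+½)^{1/4})⁻¹`,  `D = β⁻²·3 K C² G²`

(`G = Σ_a |a+½|^{-3/2}`, `H = Σ_a |a+½|^{-11/8}`) — the inequality of the registered stub, for this carrier, with thresholds `L₀ = 0`,
`Mth = id`.  ASSEMBLY: (i) each kept term is ONE momentum average over `(ℤ/L)⁴` of the `L`-independent integrand
`G_z(w) = g_a(w_I) g_b(w_II) g_{n+b-a}(z + w_II - w_I)` at `z = p_k` (`momentumAverage_momentumAverage_eq`, exact torus conservation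
`apply_latticeMomentum_add_sub`); (ii) `G_z` is `4KC²·w_n(a,b)`-Lipschitz in `w` and `KC²·w_n(a,b)·Σ|z-z′|_𝕋`-close to `G_{z′}`
(`norm_sub_le_mul_tmod_of_periodic`), so the two-volume Riemann lemma `norm_momentumAverage_sub_momentumAverage_le` gives the rate
`16π K C² w_n(a,b)/L + K C² w_n(a,b)·Σ|·|_𝕋` per term, summed with `Σ_{(a,b)} w_n(a,b) ≤ 3G²` (`klsf_tsum_sunsetWeight_le`, uniform in `n`);
(iii) the CUTOFF MISMATCH — terms kept at one of `M`, `M′` only — is bounded by the `n`-UNIFORM tail `klst_tsum_sunsetWeight_indicator_le_of_cutoff`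
(`≤ ((M+½)^{1/4})⁻¹·3H²`), which is where the Cauchy form needs more than the per-`m` VL text.  The abstract two-cutoff bookkeeping is isolated in
`klsr_norm_tsum_kept_sub_le`.  Nothing is asserted about the Hubbard model; the frame-propagator instance is the companion file
`…VolumeLimitSunsetFrameRate`.

References: G. Benfatto, A. Giuliani, V. Mastropietro, Ann. Henri Poincaré 7 (2006) 809–898, §2.1 (2.3)–(2.8), §2.4; S. Friedli, Y. Velenik,
*Statistical Mechanics of Lattice Systems* (2017) §10.5.2 (10.41) (Riemann sums on the torus).
-/

noncomputable section

namespace Summit.HubbardSuperconductivity.HubbardSuperconductivity.Theorems.KLRegimeSplit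

set_option linter.dupNamespace false -- summit = problem name (single-conjunct summit), D-0017

open Filter Topology Finset Real Literature.MathematicalPhysics.QuantumLattice Literature.Probability.LatticeModels
open Summit.HubbardSuperconductivity.HubbardSuperconductivity.Theorems.KLProgrammeLegKernels
open scoped NNReal

/-! ## §4 Two cutoffs: the abstract bookkeeping of kept sets (Riemann part + the two `n`-uniform tails) -/

/-- **Two-cutoff bookkeeping.**  Let `V, V′ : ℤ² → ℂ` be term values with `‖V‖, ‖V′‖ ≤ A·w_n` and `‖V − V′‖ ≤ E·w_n` termwise
(`w_n(a,b) = (|a+½||b+½||n+b-a+½|)⁻¹`).  Then the difference of the two KEPT sums at cutoffs `M`, `M′` is at most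
`E·3G² + A·(τ M + τ M′)`, `τ M = ((M+½)^{1/4})⁻¹·3H²`: the commonly kept terms contribute `E Σ w_n ≤ E·3G²`
(`klsf_tsum_sunsetWeight_le`), the terms kept at one cutoff only contribute the `n`-uniform tails
(`klst_tsum_sunsetWeight_indicator_le_of_cutoff`). -/
theorem klsr_norm_tsum_kept_sub_le (n : ℤ) (M M' : ℕ) (V V' : ℤ × ℤ → ℂ) {A E : ℝ} (hA : 0 ≤ A) (hE : 0 ≤ E)
    (hV : ∀ ab : ℤ × ℤ, ‖V ab‖ ≤ A * (|(ab.1 : ℝ) + 1 / 2| * |(ab.2 : ℝ) + 1 / 2| * |((n + ab.2 - ab.1 : ℤ) : ℝ) + 1 / 2|)⁻¹)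
    (hV' : ∀ ab : ℤ × ℤ, ‖V' ab‖ ≤ A * (|(ab.1 : ℝ) + 1 / 2| * |(ab.2 : ℝ) + 1 / 2| * |((n + ab.2 - ab.1 : ℤ) : ℝ) + 1 / 2|)⁻¹)
    (hVV' : ∀ ab : ℤ × ℤ,
      ‖V ab - V' ab‖ ≤ E * (|(ab.1 : ℝ) + 1 / 2| * |(ab.2 : ℝ) + 1 / 2| * |((n + ab.2 - ab.1 : ℤ) : ℝ) + 1 / 2|)⁻¹) :
    ‖(∑' ab : ℤ × ℤ,
        if ab.1 ∈ Finset.Icc (-(M : ℤ)) ((M : ℤ) - 1) ∧ ab.2 ∈ Finset.Icc (-(M : ℤ)) ((M : ℤ) - 1) ∧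
            n + ab.2 - ab.1 ∈ Finset.Icc (-(M : ℤ)) ((M : ℤ) - 1) then V ab else 0) -
      ∑' ab : ℤ × ℤ,
        if ab.1 ∈ Finset.Icc (-(M' : ℤ)) ((M' : ℤ) - 1) ∧ ab.2 ∈ Finset.Icc (-(M' : ℤ)) ((M' : ℤ) - 1) ∧
            n + ab.2 - ab.1 ∈ Finset.Icc (-(M' : ℤ)) ((M' : ℤ) - 1) then V' ab else 0‖ ≤
      E * (3 * (∑' a : ℤ, (|(a : ℝ) + 1 / 2| * Real.sqrt |(a : ℝ) + 1 / 2|)⁻¹) ^ 2) +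
        A * ((((M : ℝ) + 1 / 2) ^ ((1 : ℝ) / 4))⁻¹ * (3 * (∑' a : ℤ, (|(a : ℝ) + 1 / 2| ^ ((11 : ℝ) / 8))⁻¹) ^ 2) +
          (((M' : ℝ) + 1 / 2) ^ ((1 : ℝ) / 4))⁻¹ * (3 * (∑' a : ℤ, (|(a : ℝ) + 1 / 2| ^ ((11 : ℝ) / 8))⁻¹) ^ 2)) := by
  -- abbreviations
  set wgt : ℤ × ℤ → ℝ := fun ab =>
    (|(ab.1 : ℝ) + 1 / 2| * |(ab.2 : ℝ) + 1 / 2| * |((n + ab.2 - ab.1 : ℤ) : ℝ) + 1 / 2|)⁻¹ with hwgt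
  set box : Finset ℤ := Finset.Icc (-(M : ℤ)) ((M : ℤ) - 1) with hbox
  set box' : Finset ℤ := Finset.Icc (-(M' : ℤ)) ((M' : ℤ) - 1) with hbox'
  set T : ℤ × ℤ → ℂ := fun ab => if ab.1 ∈ box ∧ ab.2 ∈ box ∧ n + ab.2 - ab.1 ∈ box then V ab else 0 with hT
  set T' : ℤ × ℤ → ℂ := fun ab => if ab.1 ∈ box' ∧ ab.2 ∈ box' ∧ n + ab.2 - ab.1 ∈ box' then V' ab else 0 with hT'
  set Gsq : ℝ := (∑' a : ℤ, (|(a : ℝ) + 1 / 2| * Real.sqrt |(a : ℝ) + 1 / 2|)⁻¹) ^ 2 with hGsq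
  set Hsq : ℝ := (∑' a : ℤ, (|(a : ℝ) + 1 / 2| ^ ((11 : ℝ) / 8))⁻¹) ^ 2 with hHsq
  have hwgt0 : ∀ ab, 0 ≤ wgt ab := fun ab => by
    have := klsf_abs_add_half_pos ab.1; have := klsf_abs_add_half_pos ab.2
    have := klsf_abs_add_half_pos (n + ab.2 - ab.1); positivity
  -- the kept families have finite support
  have hTs : Summable T := by
    refine summable_of_ne_finset_zero (s := box ×ˢ box) fun ab hab => ?_
    simp only [hT]
    rw [if_neg]
    intro h
    exact hab (Finset.mem_product.2 ⟨h.1, h.2.1⟩)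
  have hT's : Summable T' := by
    refine summable_of_ne_finset_zero (s := box' ×ˢ box') fun ab hab => ?_
    simp only [hT']
    rw [if_neg]
    intro h
    exact hab (Finset.mem_product.2 ⟨h.1, h.2.1⟩)
  show ‖∑' ab, T ab - ∑' ab, T' ab‖ ≤ E * (3 * Gsq) + A * ((((M : ℝ) + 1 / 2) ^ ((1 : ℝ) / 4))⁻¹ * (3 * Hsq) +
    (((M' : ℝ) + 1 / 2) ^ ((1 : ℝ) / 4))⁻¹ * (3 * Hsq))
  rw [← hTs.tsum_sub hT's]
  -- the majorant family
  set F : ℤ × ℤ → ℝ := fun ab => E * wgt ab +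
    A * (if ¬(ab.1 ∈ box' ∧ ab.2 ∈ box' ∧ n + ab.2 - ab.1 ∈ box') then wgt ab else 0) +
    A * (if ¬(ab.1 ∈ box ∧ ab.2 ∈ box ∧ n + ab.2 - ab.1 ∈ box) then wgt ab else 0) with hF
  have hptw : ∀ ab, ‖T ab - T' ab‖ ≤ F ab := by
    intro ab
    have hw := hwgt0 ab
    have hEw : 0 ≤ E * wgt ab := mul_nonneg hE hw
    have hAw : 0 ≤ A * wgt ab := mul_nonneg hA hw
    simp only [hT, hT', hF]
    by_cases hk : ab.1 ∈ box ∧ ab.2 ∈ box ∧ n + ab.2 - ab.1 ∈ box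
    · by_cases hk' : ab.1 ∈ box' ∧ ab.2 ∈ box' ∧ n + ab.2 - ab.1 ∈ box'
      · rw [if_pos hk, if_pos hk', if_neg (not_not_intro hk'), if_neg (not_not_intro hk), mul_zero, add_zero, add_zero]
        exact hVV' ab
      · rw [if_pos hk, if_neg hk', if_pos hk', if_neg (not_not_intro hk), sub_zero, mul_zero, add_zero]
        exact (hV ab).trans (by linarith)
    · by_cases hk' : ab.1 ∈ box' ∧ ab.2 ∈ box' ∧ n + ab.2 - ab.1 ∈ box'
      · rw [if_neg hk, if_pos hk', if_neg (not_not_intro hk'), if_pos hk, zero_sub, norm_neg, mul_zero, add_zero]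
        exact (hV' ab).trans (by linarith)
      · rw [if_neg hk, if_neg hk', if_pos hk', if_pos hk, sub_zero, norm_zero]
        linarith
  -- summability of the majorant and of the norms
  have hP' : ∀ ab : ℤ × ℤ, ¬(ab.1 ∈ box' ∧ ab.2 ∈ box' ∧ n + ab.2 - ab.1 ∈ box') →
      ab.1 ∉ box' ∨ ab.2 ∉ box' ∨ n + ab.2 - ab.1 ∉ box' := fun ab h => by
    rcases not_and_or.1 h with h1 | h23
    · exact Or.inl h1
    · rcases not_and_or.1 h23 with h2 | h3
      · exact Or.inr (Or.inl h2)
      · exact Or.inr (Or.inr h3)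
  have hP : ∀ ab : ℤ × ℤ, ¬(ab.1 ∈ box ∧ ab.2 ∈ box ∧ n + ab.2 - ab.1 ∈ box) →
      ab.1 ∉ box ∨ ab.2 ∉ box ∨ n + ab.2 - ab.1 ∉ box := fun ab h => by
    rcases not_and_or.1 h with h1 | h23
    · exact Or.inl h1
    · rcases not_and_or.1 h23 with h2 | h3
      · exact Or.inr (Or.inl h2)
      · exact Or.inr (Or.inr h3)
  obtain ⟨hind's, hind'le⟩ := klst_tsum_sunsetWeight_indicator_le_of_cutoff n M'
    (fun ab : ℤ × ℤ => ¬(ab.1 ∈ box' ∧ ab.2 ∈ box' ∧ n + ab.2 - ab.1 ∈ box')) hP'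
  obtain ⟨hinds, hindle⟩ := klst_tsum_sunsetWeight_indicator_le_of_cutoff n M
    (fun ab : ℤ × ℤ => ¬(ab.1 ∈ box ∧ ab.2 ∈ box ∧ n + ab.2 - ab.1 ∈ box)) hP
  have hws : Summable wgt := klsf_summable_sunsetWeight n
  have hF1 : Summable fun ab : ℤ × ℤ => E * wgt ab := hws.mul_left E
  have hF2 : Summable fun ab : ℤ × ℤ =>
      A * (if ¬(ab.1 ∈ box' ∧ ab.2 ∈ box' ∧ n + ab.2 - ab.1 ∈ box') then wgt ab else 0) := hind's.mul_left A
  have hF3 : Summable fun ab : ℤ × ℤ =>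
      A * (if ¬(ab.1 ∈ box ∧ ab.2 ∈ box ∧ n + ab.2 - ab.1 ∈ box) then wgt ab else 0) := hinds.mul_left A
  have hFs : Summable F := (hF1.add hF2).add hF3
  have hnorms : Summable fun ab => ‖T ab - T' ab‖ := Summable.of_nonneg_of_le (fun _ => norm_nonneg _) hptw hFs
  calc ‖∑' ab, (T ab - T' ab)‖ ≤ ∑' ab, ‖T ab - T' ab‖ := norm_tsum_le_tsum_norm hnorms
    _ ≤ ∑' ab, F ab := hnorms.tsum_le_tsum hptw hFs
    _ = E * ∑' ab, wgt ab +
          A * ∑' ab : ℤ × ℤ, (if ¬(ab.1 ∈ box' ∧ ab.2 ∈ box' ∧ n + ab.2 - ab.1 ∈ box') then wgt ab else 0) +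
          A * ∑' ab : ℤ × ℤ, (if ¬(ab.1 ∈ box ∧ ab.2 ∈ box ∧ n + ab.2 - ab.1 ∈ box) then wgt ab else 0) := by
        rw [hF, (hF1.add hF2).tsum_add hF3, hF1.tsum_add hF2, tsum_mul_left, tsum_mul_left, tsum_mul_left]
    _ ≤ E * (3 * Gsq) + A * ((((M' : ℝ) + 1 / 2) ^ ((1 : ℝ) / 4))⁻¹ * (3 * Hsq)) +
          A * ((((M : ℝ) + 1 / 2) ^ ((1 : ℝ) / 4))⁻¹ * (3 * Hsq)) := by
        gcongr
        · exact klsf_tsum_sunsetWeight_le n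
    _ = E * (3 * Gsq) + A * ((((M : ℝ) + 1 / 2) ^ ((1 : ℝ) / 4))⁻¹ * (3 * Hsq) +
          (((M' : ℝ) + 1 / 2) ^ ((1 : ℝ) / 4))⁻¹ * (3 * Hsq)) := by ring

/-! ## §5 The two-volume rate of the sunset functional -/

section Main

variable {g : ℤ → (Fin 2 → ℝ) → ℂ} {C K : ℝ}

/-- Monotonicity of the tail constant: `((M+½)^{1/4})⁻¹ ≤ ((L+½)^{1/4})⁻¹` for `L ≤ M`. -/
theorem klsr_tailConst_anti {L M : ℕ} (h : L ≤ M) :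
    (((M : ℝ) + 1 / 2) ^ ((1 : ℝ) / 4))⁻¹ ≤ (((L : ℝ) + 1 / 2) ^ ((1 : ℝ) / 4))⁻¹ := by
  have hL : (0 : ℝ) < (L : ℝ) + 1 / 2 := by positivity
  have hLM : (L : ℝ) + 1 / 2 ≤ (M : ℝ) + 1 / 2 := by
    have : (L : ℝ) ≤ M := by exact_mod_cast h
    linarith
  exact inv_anti₀ (Real.rpow_pos_of_pos hL _) (Real.rpow_le_rpow hL.le hLM (by norm_num))

/-- **THE ORDER-`U²` RUNG OF THE CAUCHY STUB, explicit form.**  For `β > 0` and an admissible symbol family with modulus (`2π`-periodic,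
`‖g_a‖ ≤ C/|a+½|`, `‖g_a(x) − g_a(y)‖ ≤ (K/|a+½|)‖x − y‖_∞`): for all volumes `L ≤ L′`, cutoffs `M ≥ L`, `M′ ≥ L′`, every spin, all frequency
labels with the same Matsubara integer and all torus momenta,
`‖klSunset L M β g (ω,k) σ − klSunset L′ M′ β g (ω′,k′) σ‖ ≤ [β⁻²·48πKC²G²/L + β⁻²·2C³·3H²·((L+½)^{1/4})⁻¹] + β⁻²·3KC²G² · Σ_i |p_k i − p′_{k′} i|_𝕋`. -/
theorem klSunset_twoVolumeRate {β : ℝ} (hβ : 0 < β) (hC : 0 ≤ C) (hK : 0 ≤ K)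
    (hg_per : ∀ (a : ℤ) (x : Fin 2 → ℝ) (m : Fin 2 → ℤ), g a (fun i => x i + 2 * π * (m i : ℝ)) = g a x)
    (hg_bdd : ∀ (a : ℤ) (x : Fin 2 → ℝ), ‖g a x‖ ≤ C / |(a : ℝ) + 1 / 2|)
    (hg_lip : ∀ (a : ℤ) (x y : Fin 2 → ℝ), ‖g a x - g a y‖ ≤ K / |(a : ℝ) + 1 / 2| * ‖x - y‖)
    {L : ℕ} [NeZero L] {M : ℕ} [NeZero M] (hLM : L ≤ M) {L' : ℕ} [NeZero L'] (hLL' : L ≤ L') {M' : ℕ} [NeZero M']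
    (hL'M' : L' ≤ M') (σ : Fin 2) {ω : MatsubaraIdx M} {ω' : MatsubaraIdx M'} (hωω' : matsubaraInt M ω = matsubaraInt M' ω')
    (k : TorusSite 2 L) (k' : TorusSite 2 L') :
    ‖klSunset L M β g (ω, k) σ - klSunset L' M' β g (ω', k') σ‖ ≤
      ((β ^ 2)⁻¹ * (16 * π * K * C ^ 2 * (3 * (∑' a : ℤ, (|(a : ℝ) + 1 / 2| * Real.sqrt |(a : ℝ) + 1 / 2|)⁻¹) ^ 2)) / L +
          (β ^ 2)⁻¹ * C ^ 3 * 2 * (3 * (∑' a : ℤ, (|(a : ℝ) + 1 / 2| ^ ((11 : ℝ) / 8))⁻¹) ^ 2) *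
            (((L : ℝ) + 1 / 2) ^ ((1 : ℝ) / 4))⁻¹) +
        (β ^ 2)⁻¹ * (K * C ^ 2 * (3 * (∑' a : ℤ, (|(a : ℝ) + 1 / 2| * Real.sqrt |(a : ℝ) + 1 / 2|)⁻¹) ^ 2)) *
          ∑ i, torusAbs (latticeMomentum L k i - latticeMomentum L' k' i) := by
  set Gsq : ℝ := (∑' a : ℤ, (|(a : ℝ) + 1 / 2| * Real.sqrt |(a : ℝ) + 1 / 2|)⁻¹) ^ 2 with hGsq
  set Hsq : ℝ := (∑' a : ℤ, (|(a : ℝ) + 1 / 2| ^ ((11 : ℝ) / 8))⁻¹) ^ 2 with hHsq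
  set n : ℤ := matsubaraInt M' ω' with hn'
  have hn : matsubaraInt M ω = n := hωω'
  set z : Fin 2 → ℝ := latticeMomentum L k with hz
  set z' : Fin 2 → ℝ := latticeMomentum L' k' with hz'
  set td : ℝ := ∑ i, torusAbs (z i - z' i) with htd
  have htd0 : 0 ≤ td := klvc_tmod_nonneg _ _
  -- the term values at the two volumes
  set V : ℤ × ℤ → ℂ := fun ab => ((β ^ 2)⁻¹ : ℝ) • (((L ^ (2 + 2) : ℕ) : ℝ)⁻¹ • ∑ r : TorusSite (2 + 2) L,
    g ab.1 (fun i => latticeMomentum L r (Fin.castAdd 2 i)) * g ab.2 (fun j => latticeMomentum L r (Fin.natAdd 2 j)) *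
      g (n + ab.2 - ab.1) (fun i => z i + latticeMomentum L r (Fin.natAdd 2 i) - latticeMomentum L r (Fin.castAdd 2 i))) with hV
  set V' : ℤ × ℤ → ℂ := fun ab => ((β ^ 2)⁻¹ : ℝ) • (((L' ^ (2 + 2) : ℕ) : ℝ)⁻¹ • ∑ r : TorusSite (2 + 2) L',
    g ab.1 (fun i => latticeMomentum L' r (Fin.castAdd 2 i)) * g ab.2 (fun j => latticeMomentum L' r (Fin.natAdd 2 j)) *
      g (n + ab.2 - ab.1) (fun i => z' i + latticeMomentum L' r (Fin.natAdd 2 i) - latticeMomentum L' r (Fin.castAdd 2 i))) with hV'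
  have h1 : klSunset L M β g (ω, k) σ = ∑' ab : ℤ × ℤ,
      if ab.1 ∈ Finset.Icc (-(M : ℤ)) ((M : ℤ) - 1) ∧ ab.2 ∈ Finset.Icc (-(M : ℤ)) ((M : ℤ) - 1) ∧
          n + ab.2 - ab.1 ∈ Finset.Icc (-(M : ℤ)) ((M : ℤ) - 1) then V ab else 0 :=
    tsum_congr fun ab => klsr_klSunsetTerm_eq_ite β hg_per ab ω k σ hn
  have h2 : klSunset L' M' β g (ω', k') σ = ∑' ab : ℤ × ℤ,
      if ab.1 ∈ Finset.Icc (-(M' : ℤ)) ((M' : ℤ) - 1) ∧ ab.2 ∈ Finset.Icc (-(M' : ℤ)) ((M' : ℤ) - 1) ∧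
          n + ab.2 - ab.1 ∈ Finset.Icc (-(M' : ℤ)) ((M' : ℤ) - 1) then V' ab else 0 :=
    tsum_congr fun ab => klsr_klSunsetTerm_eq_ite β hg_per ab ω' k' σ hn'.symm
  rw [h1, h2]
  have hA : 0 ≤ (β ^ 2)⁻¹ * C ^ 3 := by positivity
  have hL : (0 : ℝ) < L := by exact_mod_cast Nat.pos_of_ne_zero (NeZero.ne L)
  set E : ℝ := (β ^ 2)⁻¹ * (16 * π * K * C ^ 2 / L + K * C ^ 2 * td) with hE
  have hE0 : 0 ≤ E := by positivity
  have hmain := klsr_norm_tsum_kept_sub_le n M M' V V' hA hE0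
    (fun ab => klsr_value_norm_le hβ hC hg_bdd ab.1 ab.2 (n + ab.2 - ab.1) z)
    (fun ab => klsr_value_norm_le hβ hC hg_bdd ab.1 ab.2 (n + ab.2 - ab.1) z')
    (fun ab => (klsr_value_sub_value_le hLL' hβ hC hK hg_per hg_bdd hg_lip ab.1 ab.2 (n + ab.2 - ab.1) z z').trans_eq
      (by rw [hE]; ring))
  have hτM := klsr_tailConst_anti hLM
  have hτM' := klsr_tailConst_anti (hLL'.trans hL'M')
  have hHsq0 : 0 ≤ 3 * Hsq := by positivity
  calc _ ≤ E * (3 * Gsq) + (β ^ 2)⁻¹ * C ^ 3 * ((((M : ℝ) + 1 / 2) ^ ((1 : ℝ) / 4))⁻¹ * (3 * Hsq) +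
          (((M' : ℝ) + 1 / 2) ^ ((1 : ℝ) / 4))⁻¹ * (3 * Hsq)) := hmain
    _ ≤ E * (3 * Gsq) + (β ^ 2)⁻¹ * C ^ 3 * ((((L : ℝ) + 1 / 2) ^ ((1 : ℝ) / 4))⁻¹ * (3 * Hsq) +
          (((L : ℝ) + 1 / 2) ^ ((1 : ℝ) / 4))⁻¹ * (3 * Hsq)) := by
        gcongr
    _ = _ := by
        rw [hE, htd]
        ring

/-- **THE ORDER-`U²` RUNG OF THE CAUCHY STUB, in the registered shape** (`∃ L₀ Mth D ρ, ρ → 0 ∧ ∀ L ≥ L₀ ∀ M ≥ Mth L ∀ L′ ≥ L ∀ M′ ≥ Mth L′ …`,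
with `L₀ = 0`, `Mth = id`): the sunset functional of an admissible symbol family with modulus satisfies the inequality of
`stub_vl_twoVolumeRate` (skeleton «cauchy» of stmt-19858) with `klSunset L M β g` in place of `klSelfEnergy L M β U μ K klE0 (nScales β + 1)`. -/
theorem klSunset_twoVolumeRate_stubShape {β : ℝ} (hβ : 0 < β) (hC : 0 ≤ C) (hK : 0 ≤ K)
    (hg_per : ∀ (a : ℤ) (x : Fin 2 → ℝ) (m : Fin 2 → ℤ), g a (fun i => x i + 2 * π * (m i : ℝ)) = g a x)
    (hg_bdd : ∀ (a : ℤ) (x : Fin 2 → ℝ), ‖g a x‖ ≤ C / |(a : ℝ) + 1 / 2|)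
    (hg_lip : ∀ (a : ℤ) (x y : Fin 2 → ℝ), ‖g a x - g a y‖ ≤ K / |(a : ℝ) + 1 / 2| * ‖x - y‖) :
    ∃ L₀ : ℕ, ∃ Mth : ℕ → ℕ, ∃ D : ℝ, ∃ ρ : ℕ → ℝ, Tendsto ρ atTop (𝓝 0) ∧
      ∀ (L : ℕ) [NeZero L], L₀ ≤ L → ∀ (M : ℕ) [NeZero M], Mth L ≤ M →
        ∀ (L' : ℕ) [NeZero L'], L ≤ L' → ∀ (M' : ℕ) [NeZero M'], Mth L' ≤ M' →
          ∀ (σ : Fin 2) (ω : MatsubaraIdx M) (ω' : MatsubaraIdx M'), matsubaraInt M ω = matsubaraInt M' ω' →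
            ∀ (k : TorusSite 2 L) (k' : TorusSite 2 L'),
              ‖klSunset L M β g (ω, k) σ - klSunset L' M' β g (ω', k') σ‖ ≤
                ρ L + D * ∑ i, torusAbs (latticeMomentum L k i - latticeMomentum L' k' i) := by
  set Gsq : ℝ := (∑' a : ℤ, (|(a : ℝ) + 1 / 2| * Real.sqrt |(a : ℝ) + 1 / 2|)⁻¹) ^ 2 with hGsq
  set Hsq : ℝ := (∑' a : ℤ, (|(a : ℝ) + 1 / 2| ^ ((11 : ℝ) / 8))⁻¹) ^ 2 with hHsq
  set c₁ : ℝ := (β ^ 2)⁻¹ * (16 * π * K * C ^ 2 * (3 * Gsq)) with hc₁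
  set c₂ : ℝ := (β ^ 2)⁻¹ * C ^ 3 * 2 * (3 * Hsq) with hc₂
  refine ⟨0, id, (β ^ 2)⁻¹ * (K * C ^ 2 * (3 * Gsq)),
    fun L => c₁ / (L : ℝ) + c₂ * (((L : ℝ) + 1 / 2) ^ ((1 : ℝ) / 4))⁻¹, ?_, ?_⟩
  · -- `ρ → 0`
    have h1 : Tendsto (fun L : ℕ => c₁ / (L : ℝ)) atTop (𝓝 0) := tendsto_const_div_atTop_nhds_zero_nat c₁
    have ha : Tendsto (fun L : ℕ => ((L : ℝ) + 1 / 2) ^ ((1 : ℝ) / 4)) atTop atTop :=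
      (tendsto_rpow_atTop (by norm_num)).comp (tendsto_atTop_add_const_right atTop (1 / 2) tendsto_natCast_atTop_atTop)
    have h2 : Tendsto (fun L : ℕ => (((L : ℝ) + 1 / 2) ^ ((1 : ℝ) / 4))⁻¹) atTop (𝓝 0) := tendsto_inv_atTop_zero.comp ha
    simpa using h1.add (h2.const_mul c₂)
  · intro L _ _ M _ hM L' _ hLL' M' _ hM' σ ω ω' hωω' k k'
    have h := klSunset_twoVolumeRate hβ hC hK hg_per hg_bdd hg_lip (L := L) (M := M) hM hLL' (M' := M') hM' σ hωω' k k'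
    simpa only [hc₁, hc₂] using h

end Main

end Summit.HubbardSuperconductivity.HubbardSuperconductivity.Theorems.KLRegimeSplit

end
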